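import Literature.NumberTheory.NumberFields.NormRelationPushforward
import HarnessLib

/-!
# The `S₃` norm relation `3 = N_{H₁} + N_{H₂} + N_{H₃} + N_C − N_G` (Biasse–Fieker–Hofmann–Page 2022, Def. 2.1 / Ex. 2.4) as a
# kernel-checked identity in `ℤ[G]`, for ANY group `G` of order `6` with three distinct subgroups of order `2` and one of order `3`

Topic `NumberTheory/NumberFields`; companion of `ClassGroupNormRelations.lean` / `NormRelationKleinFour.lean` (cell `bsd-potss`).
THEOREM-ONLY file (no definition, no named fact, no `sorry`), written by the prover seat `bsd-line-att-p4` g28 (cell `bsd-f1-sign2`,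
route `AlignedTransportAtTwo`, crux C2: the `μ`-descent at `p = 2` from the `S₃`-sextic `ℚ(W[2])` of an elliptic curve to its cubic
and quadratic subfields; `--supports` stmt-BirchSwinnertonDyer-22298, closes nothing).

[BiasseEtAl2022] J.-F. Biasse, C. Fieker, T. Hofmann, A. Page, *Norm relations and computational problems in number fields*,
J. London Math. Soc. 105 (2022) 2373–2414, Def. 2.1 and §2 (held text `paper:arxiv-2002.12332`): a norm relation of `G` with respect
to subgroups `Hᵢ` and denominator `d` is an identity `d = ∑ᵢ aᵢ N_{Hᵢ} bᵢ` in `ℤ[G]`.  For `G = S₃` with its three subgroups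
`H₁, H₂, H₃` of order `2`, its subgroup `C` of order `3` and `G` itself one has
  `3·1 = N_{H₁} + N_{H₂} + N_{H₃} + N_C − N_G`
(coefficient of `1`: `3 + 1 − 1 = 3`; of an involution: `1 − 1 = 0`; of an element of order `3`: `1 − 1 = 0`) — the classical
relation behind `h(L) h(ℚ)² = h(K)² h(k)` up to units for an `S₃`-sextic `L` with cubic subfield `K` and quadratic resolvent `k`
(Brauer–Kuroda).  Its denominator `d = 3` is ODD, so it feeds the `2`-adic class-number inequality
`NormRelation.padicValNat_card_classGroup_le_sum_of_normRelation` (`v₂ h(L) ≤ 3 v₂ h(K) + v₂ h(k) + v₂ h(F)`) and the μ-descent at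
`p = 2` along cyclotomic `ℤ₂`-towers (`IwasawaTheory.classNumberPExp_restrict_le_sum_of_normRelation`).

* `normRelation_card_six` — the relation in the coefficientwise form `hrel` consumed by those theorems, for ANY group `G` with
  `Nat.card G = 6`, pairwise distinct subgroups `H₁, H₂, H₃` with `Nat.card Hᵢ = 2` and a subgroup `C` with `Nat.card C = 3` (then
  `G = C ⊔ {u₁, u₂, u₃}` with `Hᵢ = {1, uᵢ}`, i.e. `G ≅ S₃`; no isomorphism with a permutation group is needed): family
  `![H₁, H₂, H₃, C, ⊤]`, `a = ![δ₁, δ₁, δ₁, δ₁, −δ₁]`, `b = δ₁`, `d = 3`, whatever `Fintype` structures the subgroups carry.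
-/

noncomputable section

namespace Literature.NumberTheory.NumberFields.NormRelation

section CardSix

variable {G : Type*} [Group G]

/-- A subgroup of order `2` is `{1, u}` for some `u ≠ 1`. [cite: BiasseEtAl2022, Def. 2.1] -/
private theorem exists_mem_iff_of_card_eq_two (H : Subgroup G) (hH : Nat.card H = 2) :
    ∃ u : G, u ≠ 1 ∧ ∀ x, x ∈ H ↔ x = 1 ∨ x = u := by
  obtain ⟨y, hy, hyuniq⟩ := (Nat.card_eq_two_iff' (⟨1, H.one_mem⟩ : H)).mp hH
  refine ⟨(y : G), fun h => hy (Subtype.ext h), fun x => ⟨fun hx => ?_, fun hx => ?_⟩⟩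
  · by_cases hx1 : x = 1
    · exact Or.inl hx1
    · right
      have := hyuniq ⟨x, hx⟩ fun h => hx1 (congrArg Subtype.val h)
      exact congrArg Subtype.val this
  · rcases hx with rfl | rfl
    · exact H.one_mem
    · exact y.2

/-- An element of a subgroup of order `2` lying in a subgroup of order `3` is trivial. [cite: BiasseEtAl2022, Def. 2.1] -/
private theorem eq_one_of_mem_of_mem {H C : Subgroup G} (hH : Nat.card H = 2) (hC : Nat.card C = 3) {x : G}
    (hxH : x ∈ H) (hxC : x ∈ C) : x = 1 := by
  have h2 : orderOf x ∣ 2 := hH ▸ H.orderOf_dvd_natCard hxH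
  have h3 : orderOf x ∣ 3 := hC ▸ C.orderOf_dvd_natCard hxC
  have h1 : orderOf x ∣ Nat.gcd 2 3 := Nat.dvd_gcd h2 h3
  rw [show Nat.gcd 2 3 = 1 from rfl, Nat.dvd_one] at h1
  exact orderOf_eq_one_iff.mp h1

/-- `∑_{h ∈ H} δ₁(h⁻¹ y) = [y ∈ H]`. [cite: BiasseEtAl2022, §2.1] -/
private theorem sum_subgroup_ite_inv_mul_eq_one [DecidableEq G] (H : Subgroup G) [Fintype H]
    [DecidablePred (· ∈ H)] (y : G) :
    (∑ h : H, (if (h : G)⁻¹ * y = 1 then (1 : ℤ) else 0)) = if y ∈ H then 1 else 0 := by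
  by_cases hy : y ∈ H
  · rw [if_pos hy, Finset.sum_eq_single (⟨y, hy⟩ : H)]
    · simp
    · intro h _ hne
      rw [if_neg]
      intro heq
      apply hne
      exact Subtype.ext (inv_mul_eq_one.mp heq)
    · intro h; exact absurd (Finset.mem_univ _) h
  · rw [if_neg hy]
    refine Finset.sum_eq_zero fun h _ => ?_
    rw [if_neg]
    intro heq
    apply hy
    rw [← inv_mul_eq_one.mp heq]
    exact h.2

/-- `∑_x z·δ₁(x)·∑_{h ∈ H} δ₁(h⁻¹x⁻¹g) = z·[g ∈ H]` — one term `a N_H b` of the relation, with `a = z·δ₁`, `b = δ₁`.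
[cite: BiasseEtAl2022, §2.1] -/
private theorem sum_ite_mul_sum_subgroup [Fintype G] [DecidableEq G] (H : Subgroup G) [Fintype H] [DecidablePred (· ∈ H)]
    (g : G) (z : ℤ) :
    (∑ x : G, ∑ h : H, (if x = 1 then z else 0) * (if (h : G)⁻¹ * x⁻¹ * g = 1 then (1 : ℤ) else 0)) =
      if g ∈ H then z else 0 := by
  rw [Finset.sum_eq_single 1]
  · have key : ∀ h : H, (if (1 : G) = 1 then z else 0) * (if (h : G)⁻¹ * 1⁻¹ * g = 1 then (1 : ℤ) else 0) =
        z * (if (h : G)⁻¹ * g = 1 then (1 : ℤ) else 0) := fun h => by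
      rw [if_pos rfl, inv_one, mul_one]
    rw [Finset.sum_congr rfl fun h _ => key h, ← Finset.mul_sum, sum_subgroup_ite_inv_mul_eq_one H g]
    by_cases hc : g ∈ H
    · rw [if_pos hc, if_pos hc, mul_one]
    · rw [if_neg hc, if_neg hc, mul_zero]
  · intro x _ hx
    rw [if_neg hx]
    simp only [zero_mul, Finset.sum_const_zero]
  · intro h; exact absurd (Finset.mem_univ _) h

/-- **In a group of order `6`, three distinct subgroups of order `2` and one of order `3` exhaust the non-trivial elements
exactly once**: for `g ≠ 1`, `g ∉ C` forces `g = uⱼ` for exactly one `j` (counting: `C ⊔ {u₁, u₂, u₃}` has `6` elements).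
[cite: BiasseEtAl2022, Def. 2.1] -/
private theorem card_six_aux [Fintype G] [DecidableEq G] (hG : Nat.card G = 6) {u₁ u₂ u₃ : G} (C : Subgroup G)
    [DecidablePred (· ∈ C)] (hC : Nat.card C = 3)
    (h1C : u₁ ∉ C) (h2C : u₂ ∉ C) (h3C : u₃ ∉ C) (h12 : u₁ ≠ u₂) (h13 : u₁ ≠ u₃) (h23 : u₂ ≠ u₃)
    {g : G} (hgC : g ∉ C) : g = u₁ ∨ g = u₂ ∨ g = u₃ := by
  classical
  set S : Finset G := (C : Set G).toFinset ∪ {u₁, u₂, u₃} with hS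
  have hCcard : ((C : Set G).toFinset).card = 3 := by
    rw [Set.toFinset_card]
    rw [← hC, Nat.card_eq_fintype_card]
    rfl
  have hdisj : Disjoint (C : Set G).toFinset ({u₁, u₂, u₃} : Finset G) := by
    rw [Finset.disjoint_left]
    intro x hx hx'
    rw [Set.mem_toFinset] at hx
    simp only [Finset.mem_insert, Finset.mem_singleton] at hx'
    rcases hx' with rfl | rfl | rfl
    · exact h1C hx
    · exact h2C hx
    · exact h3C hx
  have h3 : ({u₁, u₂, u₃} : Finset G).card = 3 := by
    rw [Finset.card_insert_of_notMem, Finset.card_insert_of_notMem, Finset.card_singleton]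
    · simpa using h23
    · simp [h12, h13]
  have hScard : S.card = 6 := by
    rw [hS, Finset.card_union_of_disjoint hdisj, hCcard, h3]
  have hSuniv : S = Finset.univ := by
    apply Finset.eq_univ_of_card
    rw [hScard, ← Nat.card_eq_fintype_card, hG]
  have hg : g ∈ S := by rw [hSuniv]; exact Finset.mem_univ g
  rw [hS, Finset.mem_union, Set.mem_toFinset] at hg
  rcases hg with hg | hg
  · exact absurd hg hgC
  · simpa only [Finset.mem_insert, Finset.mem_singleton] using hg

/-- The relation for given subgroups `Hⱼ = {1, uⱼ}` (`j = 1, 2, 3`, the `uⱼ` pairwise distinct), `C` of order `3`, and `⊤`, in a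
group of order `6`. [cite: BiasseEtAl2022, Def. 2.1] -/
private theorem card_six_rel [Fintype G] [DecidableEq G] (hG : Nat.card G = 6) (H₁ H₂ H₃ C : Subgroup G)
    [Fintype H₁] [Fintype H₂] [Fintype H₃] [Fintype C] [Fintype (⊤ : Subgroup G)]
    (hH₁ : Nat.card H₁ = 2) (hH₂ : Nat.card H₂ = 2) (hH₃ : Nat.card H₃ = 2)
    (h12 : H₁ ≠ H₂) (h13 : H₁ ≠ H₃) (h23 : H₂ ≠ H₃) (hC : Nat.card C = 3) (g : G) :
    (∑ x : G, ∑ h : H₁, (if x = 1 then (1 : ℤ) else 0) * (if (h : G)⁻¹ * x⁻¹ * g = 1 then (1 : ℤ) else 0)) +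
    (∑ x : G, ∑ h : H₂, (if x = 1 then (1 : ℤ) else 0) * (if (h : G)⁻¹ * x⁻¹ * g = 1 then (1 : ℤ) else 0)) +
    (∑ x : G, ∑ h : H₃, (if x = 1 then (1 : ℤ) else 0) * (if (h : G)⁻¹ * x⁻¹ * g = 1 then (1 : ℤ) else 0)) +
    (∑ x : G, ∑ h : C, (if x = 1 then (1 : ℤ) else 0) * (if (h : G)⁻¹ * x⁻¹ * g = 1 then (1 : ℤ) else 0)) +
    (∑ x : G, ∑ h : (⊤ : Subgroup G), (if x = 1 then (-1 : ℤ) else 0) * (if (h : G)⁻¹ * x⁻¹ * g = 1 then (1 : ℤ) else 0)) =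
      if g = 1 then ((3 : ℕ) : ℤ) else 0 := by
  classical
  rw [sum_ite_mul_sum_subgroup H₁, sum_ite_mul_sum_subgroup H₂, sum_ite_mul_sum_subgroup H₃, sum_ite_mul_sum_subgroup C,
    sum_ite_mul_sum_subgroup ⊤, if_pos (Subgroup.mem_top g)]
  obtain ⟨u₁, hu₁, m₁⟩ := exists_mem_iff_of_card_eq_two H₁ hH₁
  obtain ⟨u₂, hu₂, m₂⟩ := exists_mem_iff_of_card_eq_two H₂ hH₂
  obtain ⟨u₃, hu₃, m₃⟩ := exists_mem_iff_of_card_eq_two H₃ hH₃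
  -- the `uⱼ` are pairwise distinct and outside `C`
  have ne_of : ∀ {H H' : Subgroup G} {u u' : G}, (∀ x, x ∈ H ↔ x = 1 ∨ x = u) → (∀ x, x ∈ H' ↔ x = 1 ∨ x = u') →
      H ≠ H' → u ≠ u' := by
    intro H H' u u' m m' hne huu'
    apply hne
    ext x
    rw [m, m', huu']
  have h12' := ne_of m₁ m₂ h12
  have h13' := ne_of m₁ m₃ h13
  have h23' := ne_of m₂ m₃ h23
  have notC : ∀ {H : Subgroup G} {u : G}, Nat.card H = 2 → (∀ x, x ∈ H ↔ x = 1 ∨ x = u) → u ≠ 1 → u ∉ C :=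
    fun {H u} hH m hu huC => hu (eq_one_of_mem_of_mem hH hC ((m u).mpr (Or.inr rfl)) huC)
  have h1C := notC hH₁ m₁ hu₁
  have h2C := notC hH₂ m₂ hu₂
  have h3C := notC hH₃ m₃ hu₃
  simp only [m₁, m₂, m₃]
  by_cases hg1 : g = 1
  · subst hg1
    simp [C.one_mem]
  · by_cases hgC : g ∈ C
    · have hg1' : ¬ (g = u₁) := fun h => h1C (h ▸ hgC)
      have hg2' : ¬ (g = u₂) := fun h => h2C (h ▸ hgC)
      have hg3' : ¬ (g = u₃) := fun h => h3C (h ▸ hgC)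
      simp [hg1, hgC, hg1', hg2', hg3']
    · rcases card_six_aux hG C hC h1C h2C h3C h12' h13' h23' hgC with rfl | rfl | rfl
      · simp [hg1, hgC, h12', h13']
      · simp [hg1, hgC, h12'.symm, h23']
      · simp [hg1, hgC, h13'.symm, h23'.symm]

/-- **The `S₃` norm relation** (`3 = N_{H₁} + N_{H₂} + N_{H₃} + N_C − N_G` in `ℤ[G]`, [BiasseEtAl2022] Def. 2.1; the relation of
`S₃` with respect to its proper subgroups, odd denominator `d = 3`): for every group `G` with `Nat.card G = 6`, pairwise distinct
subgroups `H₁, H₂, H₃` of order `2` and a subgroup `C` of order `3`, in the coefficientwise form `hrel` of `ClassGroupNormRelations.lean`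
with the family `H = (H₁, H₂, H₃, C, ⊤)`, `a = (δ₁, δ₁, δ₁, δ₁, −δ₁)`, `b = (δ₁, …, δ₁)`:
`∑ᵢ ∑ₓ ∑_{h ∈ Hᵢ} aᵢ(x) bᵢ(h⁻¹x⁻¹g) = 3·[g = 1]` for all `g ∈ G` (whatever `Fintype` structures the subgroups carry).  Since `2 ∤ 3` it
feeds `padicValNat_card_classGroup_le_sum_of_normRelation` at `p = 2` (`v₂ h(L) ≤ v₂ h(L^{H₁}) + v₂ h(L^{H₂}) + v₂ h(L^{H₃}) + v₂ h(L^C) + v₂ h(F)`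
for a Galois `L/F` with group of order `6` that is not cyclic) and the μ-descent `IwasawaTheory.classNumberPExp_restrict_le_sum_of_normRelation`.
[cite: BiasseEtAl2022, Def. 2.1 and Prop. 3.7] -/
theorem normRelation_card_six [Fintype G] [DecidableEq G] (hG : Nat.card G = 6) (H₁ H₂ H₃ C : Subgroup G)
    (hH₁ : Nat.card H₁ = 2) (hH₂ : Nat.card H₂ = 2) (hH₃ : Nat.card H₃ = 2)
    (h12 : H₁ ≠ H₂) (h13 : H₁ ≠ H₃) (h23 : H₂ ≠ H₃) (hC : Nat.card C = 3)
    [hF : ∀ i, Fintype ↥((![H₁, H₂, H₃, C, ⊤] : Fin 5 → Subgroup G) i)]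
    (g : G) :
    (∑ i : Fin 5, ∑ x : G,
      ∑ h : (![H₁, H₂, H₃, C, ⊤] : Fin 5 → Subgroup G) i,
        (![fun x => if x = 1 then (1 : ℤ) else 0, fun x => if x = 1 then (1 : ℤ) else 0,
            fun x => if x = 1 then (1 : ℤ) else 0, fun x => if x = 1 then (1 : ℤ) else 0,
            fun x => if x = 1 then (-1 : ℤ) else 0] : Fin 5 → G → ℤ) i x *
          (fun (_ : Fin 5) (y : G) => if y = 1 then (1 : ℤ) else 0) i
            (((h : G))⁻¹ * x⁻¹ * g)) =
      if g = 1 then ((3 : ℕ) : ℤ) else 0 := by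
  rw [Fin.sum_univ_five]
  exact @card_six_rel G _ _ _ hG H₁ H₂ H₃ C (hF 0) (hF 1) (hF 2) (hF 3) (hF 4) hH₁ hH₂ hH₃ h12 h13 h23 hC g

end CardSix

end Literature.NumberTheory.NumberFields.NormRelation

end
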